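import Literature.MathematicalPhysics.QuantumFieldTheory.Balaban1983to89.T4ShellMeasure
import Literature.MathematicalPhysics.QuantumFieldTheory.Balaban1983to89.T4SupCloseLiaison

/-!
# `T4Continuum.ShellMeasureThresholdUnits` — owner audit (γ8) «CURRENCY OF THE CLOSENESS BINDER»: the units in which
# the live-level END (fine currency `εθ·η²`) feeds END-I (threshold units) and meets node U1b's rate (kernel bookkeeping)
(cell `pub-balaban`, sub-cell `t4`, spine estimate NE7c (node U5b); owner lineage `b2b-balaban-t4-ne7c-p1` gen 33,
owner table `t4/b2b-balaban-t4-ne7c-p1/LEAVES-NE7c-P1.md` row **S90**, owner NOTE N-ne7cp1-g33-1; ADDITIVE — imports the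
tree leaves `T4ShellMeasure` (p185315) and `T4SupCloseLiaison` (pv25 liaison U1b → U5b) ONLY, cited BY NAME; [folklore];
0 `def`, 0 `def … : Prop`, 0 sorry, 0 citation tags)

HONEST FRAMING.  Finite four-torus programme, rung (B)+1 only — NOT infinite volume, NOT a mass gap, NOT the Clay
problem, NOT summit progress; (B), `BetaPertHyp`, (B^μ) not consumed.  NE7c (`T4IndicatorShell.ShellWeightBound`) is NOT
PRINTED in [Balaban 1983–89] and NOT PROVED; «NE7c ⇐ the named binders» (trigger c3).  Nothing printed is asserted
here; no estimate of Bałaban's is discharged; this file is a UNITS audit of OUR junction END-II → END-I → node U1b.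

THE AUDIT THIS FILE SERVES (WALL-NE7c-P1 v2.3.2 §2 (g)∕(h), §2b last rows «`θ`, `δ`, `ρ`, `β`» and «END-I junction»).
* The live-level END-II hosts (S76 `ShellMeasureLandauEndRayStokes…`, S80 `…Assembled`, `…AssembledSchwarz`) conclude
  (M1) `SlotAntiConcentration ((fieldMeasure P j SU2).withDensity F) u (εθ * η ^ 2) ρ D` in the FINE currency: the tested
  variable `u = max_p ‖hol(∂p) − 1‖` is the un-normalised plaquette deviation of the localized minimiser on the run's own
  fine lattice, the threshold is `εθ·η²` with `η = η_j = L^{−j}` a free positive real of the host ([Balaban1988Convergent]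
  (2.17) `|U_{k,□}(V_k,∂p) − 1| < ε_kη²` is the LOCATOR of the shape, not a citation for a step).
* END-I (`ShellMeasureRootCompositionHistoriesSync.shellWeightBound_histories_age` ∕ `…Sync.shellWeightBound_of_schemeData_age`)
  takes the per-slot (M1) at the AGE-ONLY threshold `ε (K − lvl K s)` — ONE profile `ε : ℕ → ℝ`, free of `K` — and the
  a.e. closeness `|uA − uB| ≤ ρ (lvl K s) · ε (K − lvl K s)` with BOTH runs' variables on the term's space against ONE
  threshold.  Since `η_{lvl}² = L^{−2(K − a)}` is NOT a function of the age `a`, the END-II conclusion enters END-I only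
  after the UNIT CHANGE `u ↦ u ∕ η²` (§1–§2: (M1) is invariant under a common positive rescaling of variable and
  threshold — the shell EVENT is unchanged), each run normalised by ITS OWN `η` (`η_j` in run A; `η_{j+1} = η_j∕L` in run
  B at the paired slot, whose fine lattice is finer by `L`).
* In THOSE units END-I's closeness binder is LITERALLY node U1b's convention `T4SupCloseLiaison.ReadsLevels` («readings …
  in threshold units common to both runs (curvature normalised by η²)») + `T4EtaRateMin.LocalRate R C ϑ` + the floor on
  the NORMALISED thresholds `θmin ≤ ε a` over the age window (`thresholdFloor_of_ageLower_window`, §5d there) — §3 fires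
  `abs_sub_le_geomWidth_mul` BY NAME in END-I's indexing: the currency CLOSES BY NAME, no new located input.
* What is NOT inhabitable (§4, kernel witnesses, like `ShellMeasureWilsonSquare.letterwise_hSM_fails`): (a) reading the
  closeness binder on the two runs' RAW fine variables — at equal curvature they differ by the factor `L²`
  (`uB = uA ∕ L²`), so on the shell `{θ(1−ρ) ≤ uA < θ}` one has `|uA − uB| ≥ θ(1−ρ)(1 − L^{−2}) > ρθ`
  (`fineCurrency_gap`, `fineCurrency_closeness_fails`: positive shell mass ⟹ `¬ ∀ᵐ`); (b) a `K`-uniform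
  `ThresholdFloor` on FINE thresholds `ε·η_K²` along the towers (`no_fine_thresholdFloor`: `η_K = L^{−K} → 0`) — the floor
  of HONEST LIMITS (b) of `T4SupCloseLiaison` is a statement about the NORMALISED profile `ε ∘ age`, never about `θ K s`
  in fine units.  The slot-indexed END-I (`…Sync`, T-NE7c-7, thresholds `θ K s`) may equally be fired in run A's fine
  units (`θ K s := ε(a)·η_j²`, run B's variable rescaled by `L²`) — §3 `close_fine_iff` shows this is the SAME inequality
  multiplied by `η_j²`; the floor is then still taken on `ε`.
CLASSIFICATION (honest): a units audit of OUR wiring; it pins WHICH variable U1b's `LocalRate` must read (the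
η²-normalised plaquette deviation of the LOCALIZED minimiser, B14 (2.16)–(2.17)) — consistent with `T4SupCloseLiaison`'s
model functional and with GAPS G-ne7cp1-14 (the η² cancellation inside (SM)).  NOTHING in the countdown moves; NE7c NOT
PROVED; spine PROVED 0∕9.  HONEST DEPENDENCY (cell): continuum YM on T⁴ ⇐ BetaPertH ∧ nine spine estimates (0/9 proved);
BetaPertH ⇐ (D1) ∧ (D4) ∧ CAP+tail; G-an2-4 gates asym, D1 and NE2/3/4.
-/

noncomputable section

open Set MeasureTheory

namespace Summit.QuantumFields.BalabanUV.T4Continuum.ShellMeasureThresholdUnits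

open scoped ENNReal
open Literature.MathematicalPhysics.QuantumFieldTheory.Balaban1983to89
open T4ShellMeasure (SlotAntiConcentration)
open T4EtaRateMin (Readings LocalRate)
open T4SupCloseLiaison (geomWidth abs_sub_le_geomWidth_mul)

variable {Ω : Type*} [MeasurableSpace Ω]

/-! ## §1 (M1) is invariant under a change of units of the tested variable -/

omit [MeasurableSpace Ω] in
/-- THE SHELL EVENT IS UNIT-FREE: for `c > 0` the shell of `u` at threshold `c·θ` is the shell of `u∕c` at threshold
`θ` (same width `ρ`). [folklore] -/
theorem shell_unitChange (u : Ω → ℝ) (θ ρ : ℝ) {c : ℝ} (hc : 0 < c) :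
    {x | c * θ * (1 - ρ) ≤ u x ∧ u x < c * θ} = {x | θ * (1 - ρ) ≤ u x / c ∧ u x / c < θ} := by
  ext x
  simp only [mem_setOf_eq]
  rw [le_div_iff₀ hc, div_lt_iff₀ hc, show c * θ * (1 - ρ) = θ * (1 - ρ) * c by ring, mul_comm c θ]

/-- **(M1) UNDER A CHANGE OF UNITS.**  For `c > 0`: (M1) for `u` at threshold `c·θ` ⟺ (M1) for `u∕c` at threshold `θ`,
with the SAME width `ρ` and the SAME constant `D` (both sides weigh the same event against the same total mass).
[folklore] -/
theorem slotAntiConcentration_unitChange_iff {μ : Measure Ω} {u : Ω → ℝ} {θ ρ D c : ℝ} (hc : 0 < c) :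
    SlotAntiConcentration μ u (c * θ) ρ D ↔ SlotAntiConcentration μ (fun x => u x / c) θ ρ D := by
  unfold SlotAntiConcentration
  rw [shell_unitChange u θ ρ hc]

/-- … the multiplicative form: (M1) for `c·u` at `c·θ` ⟺ (M1) for `u` at `θ`. [folklore] -/
theorem slotAntiConcentration_mul_iff {μ : Measure Ω} {u : Ω → ℝ} {θ ρ D c : ℝ} (hc : 0 < c) :
    SlotAntiConcentration μ (fun x => c * u x) (c * θ) ρ D ↔ SlotAntiConcentration μ u θ ρ D := by
  rw [slotAntiConcentration_unitChange_iff hc]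
  simp only [mul_div_cancel_left₀ _ hc.ne']

/-- **THE FINE CURRENCY OF THE LIVE-LEVEL END ⟺ THRESHOLD UNITS.**  (M1) for the un-normalised tested variable `u` at
the END-II threshold `εθ·η²` (`η > 0`) ⟺ (M1) for the η²-NORMALISED variable `u∕η²` at the age threshold `εθ` — the form
END-I's `hacA`∕`hacB` take (`ε (K − lvl K s)`).  Same `ρ`, same `D`. [folklore] -/
theorem slotAntiConcentration_fine_iff {μ : Measure Ω} {u : Ω → ℝ} {εθ η ρ D : ℝ} (hη : 0 < η) :
    SlotAntiConcentration μ u (εθ * η ^ 2) ρ D ↔ SlotAntiConcentration μ (fun x => u x / η ^ 2) εθ ρ D := by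
  rw [mul_comm εθ, slotAntiConcentration_unitChange_iff (pow_pos hη 2)]

/-- the direction the junction uses: fine-currency (M1) ⟹ (M1) in threshold units. [folklore] -/
theorem slotAntiConcentration_thresholdUnits {μ : Measure Ω} {u : Ω → ℝ} {εθ η ρ D : ℝ} (hη : 0 < η)
    (h : SlotAntiConcentration μ u (εθ * η ^ 2) ρ D) :
    SlotAntiConcentration μ (fun x => u x / η ^ 2) εθ ρ D :=
  (slotAntiConcentration_fine_iff hη).1 h

/-- … and RUN B IN RUN A's FINE UNITS: (M1) for run B's raw variable `uB` at ITS threshold `εθ·ηB²` ⟺ (M1) for the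
rescaled variable `(ηA∕ηB)²·uB` at run A's threshold `εθ·ηA²` (the slot-indexed END-I `…Sync` fired in run A's fine units,
T-NE7c-7). [folklore] -/
theorem slotAntiConcentration_rescale_iff {μ : Measure Ω} {uB : Ω → ℝ} {εθ ηA ηB ρ D : ℝ} (hA : 0 < ηA)
    (hB : 0 < ηB) :
    SlotAntiConcentration μ uB (εθ * ηB ^ 2) ρ D ↔
      SlotAntiConcentration μ (fun x => (ηA / ηB) ^ 2 * uB x) (εθ * ηA ^ 2) ρ D := by
  rw [slotAntiConcentration_fine_iff hB, slotAntiConcentration_fine_iff hA]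
  have : ∀ x, (ηA / ηB) ^ 2 * uB x / ηA ^ 2 = uB x / ηB ^ 2 := fun x => by
    field_simp
  simp only [this]

/-! ## §2 The per-slot family form END-I consumes -/

section Family

variable {σ : Type*} {X : σ → Type*} [∀ s, MeasurableSpace (X s)]

/-- **END-I's `hac` SLOT FROM FINE-CURRENCY (M1)s WITH LEVEL-DEPENDENT `η`.**  For a finite family of live slots
`s ∈ C` with levels `lvl s`, age thresholds `ε (K − lvl s)`, widths `ρ (lvl s)`, constants `D (lvl s)` and fine scales
`η (lvl s) > 0` (run A: `η_j = L^{−j}`): the END-II conclusions at thresholds `ε(K − lvl s)·η(lvl s)²` give END-I's binder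
for the normalised variables `u s ∕ η(lvl s)²` at the age thresholds — LITERALLY the shape of
`ShellMeasureRootCompositionSync.shellWeightBound_of_schemeData_age`'s `hacA` (whose `εA` is a function of the age
alone and could not absorb `η(lvl s)²`). [folklore] -/
theorem hac_thresholdUnits {C : Finset σ} {lvl : σ → ℕ} {K : ℕ} {μ : ∀ s, Measure (X s)} {u : ∀ s, X s → ℝ}
    {ε η ρ D : ℕ → ℝ} (hη : ∀ j, 0 < η j)
    (hac : ∀ s ∈ C, SlotAntiConcentration (μ s) (u s) (ε (K - lvl s) * η (lvl s) ^ 2) (ρ (lvl s)) (D (lvl s))) :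
    ∀ s ∈ C, SlotAntiConcentration (μ s) (fun x => u s x / η (lvl s) ^ 2) (ε (K - lvl s)) (ρ (lvl s)) (D (lvl s)) :=
  fun s hs => slotAntiConcentration_thresholdUnits (hη _) (hac s hs)

/-- … run B at the paired slot (level `lvl s + 1` in the `(K+1)`-step run, SAME age `K − lvl s`), normalised by ITS OWN
scale `η (lvl s + 1)`: the shape of `…_of_schemeData_age`'s `hacB`. [folklore] -/
theorem hacB_thresholdUnits {C : Finset σ} {lvl : σ → ℕ} {K : ℕ} {μ : ∀ s, Measure (X s)} {u : ∀ s, X s → ℝ}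
    {ε η ρ D : ℕ → ℝ} (hη : ∀ j, 0 < η j)
    (hac : ∀ s ∈ C,
      SlotAntiConcentration (μ s) (u s) (ε (K - lvl s) * η (lvl s + 1) ^ 2) (ρ (lvl s)) (D (lvl s))) :
    ∀ s ∈ C,
      SlotAntiConcentration (μ s) (fun x => u s x / η (lvl s + 1) ^ 2) (ε (K - lvl s)) (ρ (lvl s)) (D (lvl s)) :=
  fun s hs => slotAntiConcentration_thresholdUnits (hη _) (hac s hs)

end Family

/-! ## §3 The closeness binder in threshold units = node U1b's rate + the floor on the NORMALISED profile, BY NAME -/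

/-- **CLOSENESS IN THRESHOLD UNITS FROM U1b's ABSOLUTE RATE** (scalar core = `T4SupCloseLiaison.abs_sub_le_geomWidth_mul`
by name).  If the two runs' NORMALISED readings `rA = uA∕ηA²`, `rB = uB∕ηB²` differ by at most `C ϑ^j` (node U1b's
`LocalRate` at the slot's level `j`) and the age threshold `εa` is at least the window floor `θmin > 0`, then
`|rA − rB| ≤ ρ_j · εa` with `ρ_j = geomWidth C θmin ϑ j = (C∕θmin)ϑ^j` — END-I's `hcloseA` at that slot. [folklore] -/
theorem close_thresholdUnits {uA uB ηA ηB C ϑ θmin εa : ℝ} {j : ℕ}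
    (h : |uB / ηB ^ 2 - uA / ηA ^ 2| ≤ C * ϑ ^ j) (hmin : 0 < θmin) (hε : θmin ≤ εa) :
    |uA / ηA ^ 2 - uB / ηB ^ 2| ≤ geomWidth C θmin ϑ j * εa :=
  abs_sub_le_geomWidth_mul h hmin hε

/-- **… FROM `LocalRate` UNDER THE REALISATION IDENTITIES** (pointwise form of `T4SupCloseLiaison.supClose_of_localRate`
in END-I's indexing): run A's normalised variable IS the `j`-step reading and run B's IS the `(j+1)`-step reading of ONE
family `R` at a common admissible datum (`ReadsLevels`), `LocalRate R C ϑ`, floor `θmin ≤ εa`. [folklore] -/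
theorem close_of_localRate {Dat Sit : Type*} {R : Readings Dat Sit} {C ϑ θmin εa rA rB : ℝ} {j : ℕ}
    (hloc : LocalRate R C ϑ) {V : Dat} (hV : V ∈ R.dom) {x : Sit} (hA : rA = R.loc j V x)
    (hB : rB = R.loc (j + 1) V x) (hmin : 0 < θmin) (hε : θmin ≤ εa) :
    |rA - rB| ≤ geomWidth C θmin ϑ j * εa := by
  subst hA hB
  exact abs_sub_le_geomWidth_mul (hloc j V hV x) hmin hε

/-- **THE a.e. FORM END-I DISPLAYS** (`hcloseA : ∀ᵐ ω ∂ν, |uA ω − uB ω| ≤ ρ (lvl K s) * ε (K − lvl K s)` with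
`uA`, `uB` the normalised variables): from the a.e. realisation identities + `LocalRate` + the floor. [folklore] -/
theorem hclose_of_localRate {Dat Sit : Type*} {R : Readings Dat Sit} {C ϑ θmin εa : ℝ} {j : ℕ}
    {ν : Measure Ω} {rA rB : Ω → ℝ} (hloc : LocalRate R C ϑ)
    (hR : ∀ᵐ ω ∂ν, ∃ V ∈ R.dom, ∃ x : Sit, rA ω = R.loc j V x ∧ rB ω = R.loc (j + 1) V x)
    (hmin : 0 < θmin) (hε : θmin ≤ εa) :
    ∀ᵐ ω ∂ν, |rA ω - rB ω| ≤ geomWidth C θmin ϑ j * εa := by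
  filter_upwards [hR] with ω hω
  obtain ⟨V, hV, x, hA, hB⟩ := hω
  exact close_of_localRate hloc hV hA hB hmin hε

/-- **THE FLOOR IS TAKEN ON THE NORMALISED PROFILE**: if the live slots have ages `≤ N₁` (the window (W1)) and the
normalised age profile satisfies `θmin ≤ ε a` for `a ≤ N₁`, every live slot's age threshold is `≥ θmin` — the
hypothesis `hε` of the three lemmas above, uniformly in `K` (cf. `T4SupCloseLiaison.thresholdFloor_of_ageLower_window`).
[folklore] -/
theorem floor_of_ageWindow {ε : ℕ → ℝ} {θmin : ℝ} {N₁ K j : ℕ} (hwin : K - j ≤ N₁)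
    (hfloor : ∀ a ≤ N₁, θmin ≤ ε a) : θmin ≤ ε (K - j) :=
  hfloor _ hwin

/-- **RUN A's FINE UNITS ARE THE SAME INEQUALITY TIMES `ηA²`** (the slot-indexed END-I `…Sync`, thresholds `θ K s`,
T-NE7c-7, fired with `θ K s := εa·ηA²` and run B's variable expressed in run A's units `(ηA∕ηB)²·uB`):
`|uA − (ηA∕ηB)²·uB| ≤ ρ·(εa·ηA²)` ⟺ `|uA∕ηA² − uB∕ηB²| ≤ ρ·εa`. [folklore] -/
theorem close_fine_iff {uA uB ηA ηB ρ εa : ℝ} (hA : 0 < ηA) (hB : 0 < ηB) :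
    |uA - (ηA / ηB) ^ 2 * uB| ≤ ρ * (εa * ηA ^ 2) ↔ |uA / ηA ^ 2 - uB / ηB ^ 2| ≤ ρ * εa := by
  have hA2 : 0 < ηA ^ 2 := pow_pos hA 2
  have hB2 : (ηB ^ 2 : ℝ) ≠ 0 := (pow_pos hB 2).ne'
  have key : uA - (ηA / ηB) ^ 2 * uB = ηA ^ 2 * (uA / ηA ^ 2 - uB / ηB ^ 2) := by
    field_simp
  rw [key, abs_mul, abs_of_pos hA2, show ρ * (εa * ηA ^ 2) = ηA ^ 2 * (ρ * εa) by ring]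
  exact mul_le_mul_iff_right₀ hA2

/-! ## §4 What is NOT inhabitable: the closeness binder on RAW fine variables, and a floor on fine thresholds -/

/-- **THE RAW FINE VARIABLES OF THE TWO RUNS ARE `L²` APART ON THE SHELL.**  At equal curvature run B's raw variable is
run A's divided by `L²` (`Lsq = L² ≥ 2`); on run A's shell `θ(1−ρ) ≤ uA` (`θ > 0`, `ρ ≤ 1∕4`) the raw discrepancy
exceeds the width: `ρθ < |uA − uA∕L²|`. [folklore] -/
theorem fineCurrency_gap {uA θ ρ Lsq : ℝ} (hθ : 0 < θ) (hρ : ρ ≤ 1 / 4) (hL : 2 ≤ Lsq)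
    (hsh : θ * (1 - ρ) ≤ uA) : ρ * θ < |uA - uA / Lsq| := by
  have hL0 : 0 < Lsq := by linarith
  have huA : 0 < uA := lt_of_lt_of_le (by nlinarith) hsh
  have hdiff : uA / 2 ≤ uA - uA / Lsq := by
    have h1 : uA / Lsq ≤ uA / 2 := div_le_div_of_nonneg_left huA.le (by norm_num) hL
    linarith
  have hpos : 0 ≤ uA - uA / Lsq := by linarith [half_pos huA]
  rw [abs_of_nonneg hpos]
  nlinarith

/-- **THE FINE-CURRENCY CLOSENESS BINDER FAILS ON ANY SHELL OF POSITIVE MASS.**  With `uB = uA∕L²` (equal curvature, raw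
variables), `θ > 0`, `ρ ≤ 1∕4`, `L² ≥ 2`: if the shell `{θ(1−ρ) ≤ uA < θ}` has positive `μ`-mass then END-I's
closeness binder read on the raw variables, `∀ᵐ x ∂μ, |uA x − uB x| ≤ ρ·θ`, is FALSE — for every summable (indeed every
`≤ 1∕4`) width.  The binder is inhabitable only in threshold units (§3). [folklore] -/
theorem fineCurrency_closeness_fails {μ : Measure Ω} {uA : Ω → ℝ} {θ ρ Lsq : ℝ} (hθ : 0 < θ)
    (hρ : ρ ≤ 1 / 4) (hL : 2 ≤ Lsq) (hshell : μ {x | θ * (1 - ρ) ≤ uA x ∧ uA x < θ} ≠ 0) :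
    ¬ (∀ᵐ x ∂μ, |uA x - uA x / Lsq| ≤ ρ * θ) := by
  intro h
  apply hshell
  refine measure_mono_null (fun x hx => ?_) (ae_iff.1 h)
  exact not_le.2 (fineCurrency_gap hθ hρ hL hx.1)

/-- … whereas in THRESHOLD UNITS the same pair is EXACTLY synchronised: `uA∕ηA² − uB∕ηB² = 0` when
`uB = (ηB∕ηA)²·uA` (equal curvature). [folklore] -/
theorem thresholdUnits_exact {uA ηA ηB : ℝ} (hA : 0 < ηA) (hB : 0 < ηB) :
    uA / ηA ^ 2 - (ηB / ηA) ^ 2 * uA / ηB ^ 2 = 0 := by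
  have hA2 : (ηA ^ 2 : ℝ) ≠ 0 := (pow_pos hA 2).ne'
  have hB2 : (ηB ^ 2 : ℝ) ≠ 0 := (pow_pos hB 2).ne'
  field_simp
  ring

/-- **NO `K`-UNIFORM FLOOR ON FINE THRESHOLDS ALONG THE TOWERS.**  For `ε > 0` and `L > 1` the fine thresholds
`ε·(L⁻¹)^(2K)` of the youngest live slot of the `K`-th comparison tend to `0`, so no `θmin > 0` bounds them below for all
`K`: `T4SupCloseLiaison.ThresholdFloor` (HONEST LIMITS (b)) is a statement about the NORMALISED profile `ε ∘ age`, never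
about thresholds in fine units. [folklore] -/
theorem no_fine_thresholdFloor {ε L : ℝ} (hL : 1 < L) :
    ¬ ∃ θmin : ℝ, 0 < θmin ∧ ∀ K : ℕ, θmin ≤ ε * (L⁻¹) ^ (2 * K) := by
  rintro ⟨θmin, hmin, hfl⟩
  have hL0 : 0 < L := by linarith
  have hq0 : 0 ≤ (L⁻¹) ^ 2 := sq_nonneg _
  have hq1 : (L⁻¹) ^ 2 < 1 := by
    have : L⁻¹ < 1 := inv_lt_one_of_one_lt₀ hL
    have h0 : 0 ≤ L⁻¹ := (inv_pos.2 hL0).le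
    nlinarith
  have ht : Filter.Tendsto (fun K : ℕ => ε * ((L⁻¹) ^ 2) ^ K) Filter.atTop (nhds (ε * 0)) :=
    (tendsto_pow_atTop_nhds_zero_of_lt_one hq0 hq1).const_mul ε
  rw [mul_zero] at ht
  have hev := (ht.eventually (gt_mem_nhds hmin))
  obtain ⟨K, hK⟩ := hev.exists
  have := hfl K
  rw [pow_mul] at this
  exact absurd (lt_of_le_of_lt this hK) (lt_irrefl _)

/-! ## §5 Non-vacuity (trigger c3) -/

/-- NON-VACUITY OF §4: on `ℝ` with Lebesgue measure, `uA = id`, `θ = 1`, `ρ = 1∕4`, `L² = 4`: the shell `[3∕4, 1)` has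
mass `1∕4 ≠ 0`, so the raw-variable closeness `|x − x∕4| ≤ 1∕4` a.e. is refuted by `fineCurrency_closeness_fails`.
[folklore] -/
example : ¬ (∀ᵐ x ∂(volume : Measure ℝ), |id x - id x / 4| ≤ 1 / 4 * 1) := by
  refine fineCurrency_closeness_fails (μ := (volume : Measure ℝ)) (uA := id) one_pos le_rfl (by norm_num) ?_
  have : {x : ℝ | 1 * (1 - 1 / 4) ≤ id x ∧ id x < 1} = Ico (3 / 4 : ℝ) 1 := by
    ext x; simp only [mem_setOf_eq, id, mem_Ico]; norm_num
  rw [this, Real.volume_Ico]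
  norm_num

/-- NON-VACUITY OF §1: the empty-shell toy of `ShellMeasureWindowRestrict` in fine units `εθ·η² = 1·(1∕2)²` transported
to threshold units by `slotAntiConcentration_fine_iff`. [folklore] -/
example : SlotAntiConcentration (volume : Measure ℝ) (fun x => id x / (1 / 2 : ℝ) ^ 2) 1 0 0 := by
  rw [← slotAntiConcentration_fine_iff (by norm_num : (0 : ℝ) < 1 / 2)]
  unfold SlotAntiConcentration
  have : {x : ℝ | 1 * (1 / 2 : ℝ) ^ 2 * (1 - 0) ≤ id x ∧ id x < 1 * (1 / 2 : ℝ) ^ 2} = ∅ := by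
    ext x; simp only [mem_setOf_eq, id, mem_empty_iff_false, iff_false, not_and, not_lt]; intro h; linarith
  rw [this, measure_empty]
  exact bot_le

end Summit.QuantumFields.BalabanUV.T4Continuum.ShellMeasureThresholdUnits

end
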